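import Summits.Ventures.QEC.CircuitDistance.PortK2DataBB144Z
import Summits.Ventures.QEC.CircuitDistance.K2Chunks
import HarnessLib

/-!
# K2(`[[144,12,12]]`) chunk module — COMPUTATIONAL (native_decide; `Lean.ofReduceBool`)

Cell `qec`, CDX, R146/R152 STEP 1 («computational» header; `ofReduceBool` confined to these chunk modules). Checker of record
`K2.K2Data` (qec-cdx-type-1, PortK2Check); data module of record `PortK2DataBB144X/Z` (p669158/9, crit-1 data audit PASS
2026-08-28T21:20Z); chunk glue `K2Chunks` (idea-1 g2). Cube 0, child 6: leaf group 8 of 11.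
Leaf theorems: the K2 DFS accepts below one descendant state of pivot cube 0 (sector Z); sizes are exact DFS visit counts
(eng-1 g2 `k2count.c`), capped so that the gate's native-axiom audit re-verifies every leaf in place. Assemblies re-derive the
child lists in the kernel (`decide`) and end in the literal cube fact `d144Z.cube (Ts144Z.getD 0 []) (0) (lives144Z.getD 0 0) = true`
(the `hcubes` hypothesis of `K2Inst.k2_complete`). Emitted by qec-cdx-eng-1 g2 (`gen2.py`, idea-1's `gen_k2chunks_from_lean.py` lineage).
-/

namespace Summit.Ventures.QEC.CircuitDistance.K2

set_option maxRecDepth 100000 in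
set_option maxHeartbeats 0 in
set_option exponentiation.threshold 1024 in
/-- K2(144) chunk fact `cube144Z0_ch6_12` (561138 DFS visits; see the module docstring). -/
theorem cube144Z0_ch6_12 : app5 (d144Z.dfs (Ts144Z.getD 0 []) 6) (3551035107411037782656, 424, 13479973333575319897334934791202521296699630497239735735688187871233, 3, 2348542582773833227889480596789337027375668226436652946151656091303621936358544340073324970945201144896421852) = true := by native_decide

set_option maxRecDepth 100000 in
set_option maxHeartbeats 0 in
set_option exponentiation.threshold 1024 in
/-- K2(144) chunk fact `cube144Z0_ch6_13` (512683 DFS visits; see the module docstring). -/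
theorem cube144Z0_ch6_13 : app5 (d144Z.dfs (Ts144Z.getD 0 []) 6) (1192157146035475482752, 2538, 862718293348820473429345910032320887516269679807267768890451910721537, 3, 2348542582773833227889480596789337027374805508143304125678226746820837308176987951451803672625805829368446940) = true := by native_decide

set_option maxRecDepth 100000 in
set_option maxHeartbeats 0 in
set_option exponentiation.threshold 1024 in
/-- K2(144) chunk fact `cube144Z0_ch6_14` (628262 DFS visits; see the module docstring). -/
theorem cube144Z0_ch6_14 : app5 (d144Z.dfs (Ts144Z.getD 0 []) 6) (3550998515664101081216, 1484, 56539106072908298546665520025200640199185444581078092629340893577746579457, 3, 2348542582773833227889480596789336970835699435235005579012706723047444801697503251431997012734407388004614108) = true := by native_decide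
end Summit.Ventures.QEC.CircuitDistance.K2
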